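import Literature.Analysis.FluidPDE.LocalTypeIMorreyProofs
import Literature.Analysis.FunctionSpaces.WeakLpQuantitative
import HarnessLib

/-!
# Seregin 2019, §2: the weak-`L³` slice bound controls the scale-invariant energies

G. Seregin, *A note on weak solutions to the Navier–Stokes equations that are locally in
`L_∞(L^{3,∞})`*, arXiv:1906.06707 = St. Petersburg Math. J. 32 (2021) 565–576, §2: for a suitable
weak solution in `Q(z₀,R)` whose slices are uniformly in weak-`L³`,
`α³ |{x ∈ B(x₀,R) : α < |v(x,t)|}| ≤ M³` (`α > 0`, `t ∈ ]t₀-R²,t₀[`), the scaled energy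
`A(z,r) = ess sup_t r⁻¹ ∫_{B(x,r)} |v|²` is bounded by `c M²` on every sub-cylinder (first display
of §2, p. 5: weak-`L³ ⊂ L²_loc` with the scale-invariant constant), and consequently — by the
local energy iteration of Seregin 2006, Lemma 2.1 (c), available in the tree as
`Seregin2020.scaledEnergies_bounded_of_cknAEss_le_unif` — ALL the scale-invariant quantities
`A + E + C + D` are bounded at all small scales around every interior point by a constant
depending only on `M` and the data `E(r₀), D(r₀)` at the top scale ((2.1), p. 5).

* (private) `eWeakLpPow_three_le_of_forall_measure` — the height-family form of the weak-`L³`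
  bound gives `sup_t t³ μ{|f| > t} ≤ M³` for any measure `μ` (here `μ = volume ⌊ B(x₀,R)`);
* `cknAEss_le_of_weakL3_slices` — (a): `A(z,r) ≤ 7 M²` whenever `Q(z,r) ⊆ Q(z₀,R)`
  (`∫_{B(x,r)} |v|² ≤ |B_r| λ² + 2 λ⁻¹ M³` with `λ = M/r`, and `4π/3 + 2 ≤ 7`);
* `scaledEnergies_bounded_of_weakL3_slices` — (c): the bound (2.1) in the engine's form,
  `A + E + C + D ≤ K(M, E₀, D₀)` on `Q(z,r)`, `0 < r ≤ r₀/2`, when `Q(z,r₀) ⊆ Q(z₀,R)`,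
  `E(z,r₀) ≤ E₀`, `D(z,r₀) ≤ D₀`; `scaledEnergies_bounded_of_weakL3_slices_osc` — the same with
  the printed mean-free `D₀ = cknDOsc` on the left.

Theorems only (no new named fact); tranche (W2) of the input `seregin2019_localWeakL3_epsRegularity`
(`Seregin2019LocalWeakL3.lean`). No Navier–Stokes regularity statement is proved here.

## References

* G. Seregin, arXiv:1906.06707, §2, first display and (2.1) (p. 5). [Seregin2019]
* G. Seregin, *Local regularity theory of the Navier–Stokes equations near the boundary*,
  arXiv:math/0607537, Lemma 2.1 (c). [Seregin2006]
* Z. Bradshaw, T.-P. Tsai, Ann. Henri Poincaré 18 (2017), §1 (`L³_w ⊂ L²_uloc`). [BradshawTsai2017AHP]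
-/

noncomputable section

open MeasureTheory Set Function Filter Topology TopologicalSpace Metric
open scoped NNReal ENNReal

namespace Literature.Analysis.FluidPDE

open Literature.Analysis.FunctionSpaces

/-- `sup_{t>0} t³ μ{|f| > t} ≤ M` from the bound at every real height `σ > 0`, for an arbitrary
measure `μ` (the height `0` contributes `0`; cf. `eWeakLpPow_three_le_of_forall` for `μ = volume`).
[folklore] -/
private theorem eWeakLpPow_three_le_of_forall_measure {α : Type*} [MeasurableSpace α] {μ : Measure α}
    {E : Type*} [NormedAddCommGroup E] {f : α → E} {M : ℝ≥0∞}
    (h : ∀ σ : ℝ, 0 < σ → ENNReal.ofReal (σ ^ 3) * μ {x | σ < ‖f x‖} ≤ M) :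
    eWeakLpPow f 3 μ ≤ M := by
  unfold eWeakLpPow
  refine iSup_le fun t => ?_
  rcases eq_or_ne t 0 with rfl | ht
  · rw [ENNReal.coe_zero, ENNReal.toReal_ofNat, ENNReal.zero_rpow_of_pos (by norm_num), zero_mul]
    exact bot_le
  have htpos : (0 : ℝ) < t := lt_of_le_of_ne t.coe_nonneg fun h0 => ht (by exact_mod_cast h0.symm)
  have e1 : ((t : ℝ≥0∞)) ^ (3 : ℝ≥0∞).toReal = ENNReal.ofReal ((t : ℝ) ^ 3) := by
    rw [ENNReal.toReal_ofNat, show ((3 : ℝ)) = ((3 : ℕ) : ℝ) by norm_num, ENNReal.rpow_natCast,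
      ENNReal.ofReal_pow t.coe_nonneg, ENNReal.ofReal_coe_nnreal]
  have e2 : {x | (t : ℝ≥0∞) < ‖f x‖ₑ} = {x | (t : ℝ) < ‖f x‖} := by
    ext x
    simp only [mem_setOf_eq]
    rw [← ofReal_norm, ← ENNReal.ofReal_coe_nnreal,
      ENNReal.ofReal_lt_ofReal_iff_of_nonneg t.coe_nonneg]
  rw [e1, e2]
  exact h t htpos

/-- **Seregin 2019, §2, first display (p. 5): `A ≤ c M²` from the weak-`L³` slice bound.** If the
slices `u(t)`, `t ∈ ]t₀-R², t₀[`, are a.e.-strongly measurable on `B(x₀,R)` and satisfy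
`α³ |{x ∈ B(x₀,R) : α < |u(t,x)|}| ≤ M³` for all `α > 0` (`M > 0`), then for every parabolic
sub-cylinder `Q(z,r) ⊆ Q(z₀,R)`, `r > 0`:
`A(z,r) = ess sup_{t ∈ ]t-r²,t[} r⁻¹ ∫_{B(x,r)} |u|² ≤ 7 M²`
(weak-`L³ ⊂ L²`: `∫_{B(x,r)}|u(t)|² ≤ |B_r| λ² + 2λ⁻¹M³` at the height `λ = M/r`, `4π/3 + 2 ≤ 7`).
[cite: Seregin2019, §2 first display (arXiv:1906.06707 p. 5)] -/
theorem cknAEss_le_of_weakL3_slices {z₀ : ℝ × EuclideanSpace ℝ (Fin 3)} {R M : ℝ} (hM : 0 < M)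
    {u : ℝ → EuclideanSpace ℝ (Fin 3) → EuclideanSpace ℝ (Fin 3)}
    (hum : ∀ᵐ t ∂(volume.restrict (Ioo (z₀.1 - R ^ 2) z₀.1)),
      AEStronglyMeasurable (u t) (volume.restrict (ball z₀.2 R)))
    (hweak : ∀ t ∈ Ioo (z₀.1 - R ^ 2) z₀.1, ∀ α : ℝ, 0 < α →
      ENNReal.ofReal (α ^ 3) *
          (volume.restrict (ball z₀.2 R)) {x : EuclideanSpace ℝ (Fin 3) | α < ‖u t x‖} ≤
        ENNReal.ofReal (M ^ 3))
    {z : ℝ × EuclideanSpace ℝ (Fin 3)} {r : ℝ} (hr : 0 < r)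
    (hsub : parabolicCylinder r z ⊆ parabolicCylinder R z₀) :
    cknAEss r z u ≤ ENNReal.ofReal (7 * M ^ 2) := by
  -- the inclusion of cylinders splits into time and space inclusions
  have hne : (parabolicCylinder r z).Nonempty := by
    refine ⟨(z.1 - r ^ 2 / 2, z.2), ?_⟩
    rw [mem_parabolicCylinder]
    refine ⟨⟨by nlinarith, by nlinarith⟩, ?_⟩
    rw [dist_self]; exact hr
  obtain ⟨hIt, hIx⟩ := (prod_subset_prod_iff' hne).1 hsub
  have hr0 : ENNReal.ofReal r ≠ 0 := (ENNReal.ofReal_pos.2 hr).ne'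
  -- the slice bound, a.e. in `t`
  unfold cknAEss
  refine essSup_le_of_ae_le _ ?_
  have hum' : ∀ᵐ t ∂(volume.restrict (Ioo (z.1 - r ^ 2) z.1)),
      AEStronglyMeasurable (u t) (volume.restrict (ball z₀.2 R)) :=
    ae_restrict_of_ae_restrict_of_subset hIt hum
  filter_upwards [hum', ae_restrict_mem measurableSet_Ioo] with t htm ht
  -- weak-`L³` size of the slice on `B(x₀,R)`
  have hW : eWeakLpPow (u t) 3 (volume.restrict (ball z₀.2 R)) ≤ ENNReal.ofReal (M ^ 3) :=
    eWeakLpPow_three_le_of_forall_measure (hweak t (hIt ht))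
  -- `∫_{B(x,r)} |u(t)|² ≤ |B_r| λ² + 2 λ⁻¹ M³` at the height `λ = M/r`
  have hlam : 0 < M / r := div_pos hM hr
  have h2 := MemWeakLp.setLIntegral_rpow_le (p := 3) (μ := volume.restrict (ball z₀.2 R)) htm
    (r := 2) zero_lt_two (by rw [ENNReal.toReal_ofNat]; norm_num) (ball z.2 r) hlam
  rw [Measure.restrict_restrict measurableSet_ball, inter_eq_left.2 hIx,
    Measure.restrict_apply measurableSet_ball, inter_eq_left.2 hIx, ENNReal.toReal_ofNat,
    EuclideanSpace.volume_ball_fin_three] at h2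
  have e2 : ∫⁻ x in ball z.2 r, ‖u t x‖ₑ ^ 2 = ∫⁻ x in ball z.2 r, ‖u t x‖ₑ ^ (2 : ℝ) :=
    lintegral_congr fun x => by rw [← ENNReal.rpow_natCast]; norm_num
  have epow1 : (M / r) ^ (2 : ℝ) = (M / r) ^ 2 := by
    rw [show (2 : ℝ) = ((2 : ℕ) : ℝ) by norm_num, Real.rpow_natCast]
  have epow2 : (M / r) ^ ((2 : ℝ) - 3) = r / M := by
    rw [show (2 : ℝ) - 3 = -1 by norm_num, Real.rpow_neg_one, inv_div]
  rw [epow1, epow2, show (2 : ℝ) / (3 - 2) = 2 by norm_num] at h2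
  -- the real-number bookkeeping: `(4π/3) r M² + 2 r M² ≤ 7 r M²`
  have hπ : Real.pi < 3.15 := Real.pi_lt_d2
  have hkey : ∫⁻ x in ball z.2 r, ‖u t x‖ₑ ^ 2 ≤ ENNReal.ofReal (7 * r * M ^ 2) := by
    rw [e2]
    refine h2.trans ?_
    calc ENNReal.ofReal r ^ 3 * ENNReal.ofReal (Real.pi * 4 / 3) * ENNReal.ofReal ((M / r) ^ 2) +
          ENNReal.ofReal (2 * (r / M)) * eWeakLpPow (u t) 3 (volume.restrict (ball z₀.2 R))
        ≤ ENNReal.ofReal r ^ 3 * ENNReal.ofReal (Real.pi * 4 / 3) * ENNReal.ofReal ((M / r) ^ 2) +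
          ENNReal.ofReal (2 * (r / M)) * ENNReal.ofReal (M ^ 3) := by gcongr
      _ = ENNReal.ofReal (r ^ 3 * (Real.pi * 4 / 3) * (M / r) ^ 2 + 2 * (r / M) * M ^ 3) := by
          rw [← ENNReal.ofReal_pow hr.le, ← ENNReal.ofReal_mul (by positivity),
            ← ENNReal.ofReal_mul (by positivity), ← ENNReal.ofReal_mul (by positivity),
            ← ENNReal.ofReal_add (by positivity) (by positivity)]
      _ ≤ ENNReal.ofReal (7 * r * M ^ 2) := by
          refine ENNReal.ofReal_le_ofReal ?_
          have e : r ^ 3 * (Real.pi * 4 / 3) * (M / r) ^ 2 + 2 * (r / M) * M ^ 3 =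
              (Real.pi * 4 / 3 + 2) * (r * M ^ 2) := by
            field_simp
          rw [e, show 7 * r * M ^ 2 = 7 * (r * M ^ 2) by ring]
          exact mul_le_mul_of_nonneg_right (by linarith) (by positivity)
  calc (ENNReal.ofReal r)⁻¹ * ∫⁻ x in ball z.2 r, ‖u t x‖ₑ ^ 2
      ≤ (ENNReal.ofReal r)⁻¹ * ENNReal.ofReal (7 * r * M ^ 2) := by gcongr
    _ = ENNReal.ofReal (7 * M ^ 2) := by
        rw [show 7 * r * M ^ 2 = r * (7 * M ^ 2) by ring, ENNReal.ofReal_mul hr.le, ← mul_assoc,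
          ENNReal.inv_mul_cancel hr0 ENNReal.ofReal_ne_top, one_mul]

/-- **Seregin 2019, §2, (2.1) (p. 5), in the form of the tree's engine: all scale-invariant
energies are bounded under the weak-`L³` slice bound.** For every `M, E₀, D₀` there is `K` such
that: if `(u,p)` is a suitable weak solution in `Q(z₀,R)` (`IsSuitableWeakSolutionInBall`) with a
weak spatial gradient `G` there, whose slices are a.e.-strongly measurable on `B(x₀,R)` and satisfy
`α³ |{x ∈ B(x₀,R) : α < |u(t,x)|}| ≤ M³` (`α > 0`, `t ∈ ]t₀-R²,t₀[`), then for every sub-cylinder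
`Q(z,r₀) ⊆ Q(z₀,R)` with `E(z,r₀) ≤ E₀` and `D(z,r₀) ≤ D₀`:
`A + E + C + D ≤ K` on `Q(z,r)` for all `0 < r ≤ r₀/2`
(`cknAEss_le_of_weakL3_slices` feeds `A ≤ 7(M+1)²` at all scales `≤ r₀` into Seregin 2006,
Lemma 2.1 (c) = `Seregin2020.scaledEnergies_bounded_of_cknAEss_le_unif`; the printed (2.1) states
the linear majorant `c(M)(D₀ + E + 1)` with the mean-free `D₀`, of which this uniform bound is the
use made in §4, "(scale inv)").
[cite: Seregin2019, §2 (2.1) (arXiv:1906.06707 p. 5); Seregin2006, Lemma 2.1 (c)] -/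
theorem scaledEnergies_bounded_of_weakL3_slices (M E₀ D₀ : ℝ≥0) : ∃ K : ℝ≥0,
    ∀ (z₀ : ℝ × EuclideanSpace ℝ (Fin 3)) (R : ℝ)
      (u : ℝ → EuclideanSpace ℝ (Fin 3) → EuclideanSpace ℝ (Fin 3))
      (p : ℝ → EuclideanSpace ℝ (Fin 3) → ℝ)
      (G : ℝ → EuclideanSpace ℝ (Fin 3) → EuclideanSpace ℝ (Fin 3) →L[ℝ] EuclideanSpace ℝ (Fin 3)),
      IsSuitableWeakSolutionInBall R z₀ u p →
      HasWeakSpatialGradientOn (parabolicCylinderOpens R z₀) u G →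
      (∀ᵐ t ∂(volume.restrict (Ioo (z₀.1 - R ^ 2) z₀.1)),
        AEStronglyMeasurable (u t) (volume.restrict (ball z₀.2 R))) →
      (∀ t ∈ Ioo (z₀.1 - R ^ 2) z₀.1, ∀ α : ℝ, 0 < α →
        ENNReal.ofReal (α ^ 3) *
            (volume.restrict (ball z₀.2 R)) {x : EuclideanSpace ℝ (Fin 3) | α < ‖u t x‖} ≤
          ENNReal.ofReal ((M : ℝ) ^ 3)) →
      ∀ (z : ℝ × EuclideanSpace ℝ (Fin 3)) (r₀ : ℝ), 0 < r₀ →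
        parabolicCylinder r₀ z ⊆ parabolicCylinder R z₀ →
        cknE r₀ z G ≤ E₀ → cknD r₀ z p ≤ D₀ →
        ∀ r ∈ Ioc (0 : ℝ) (r₀ / 2), cknAEss r z u + cknE r z G + cknC r z u + cknD r z p ≤ K := by
  obtain ⟨K, hK⟩ := Seregin2020.scaledEnergies_bounded_of_cknAEss_le_unif (7 * (M + 1) ^ 2) E₀ D₀
  refine ⟨K, fun z₀ R u p G hsol hG hum hweak z r₀ hr₀ hsub hE hD r hr => ?_⟩
  refine hK (parabolicCylinderOpens R z₀) u p G hsol.1 hG z r₀ hr₀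
    (by rw [coe_parabolicCylinderOpens]; exact hsub) hE hD (fun ρ hρ => ?_) r hr
  -- `A(z,ρ) ≤ 7 (M+1)²` for `0 < ρ ≤ r₀` from the slice bound (with `M+1 > 0` in place of `M`)
  have hM1 : 0 < (M : ℝ) + 1 := by positivity
  have hweak' : ∀ t ∈ Ioo (z₀.1 - R ^ 2) z₀.1, ∀ α : ℝ, 0 < α →
      ENNReal.ofReal (α ^ 3) *
          (volume.restrict (ball z₀.2 R)) {x : EuclideanSpace ℝ (Fin 3) | α < ‖u t x‖} ≤
        ENNReal.ofReal (((M : ℝ) + 1) ^ 3) :=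
    fun t ht α hα => (hweak t ht α hα).trans
      (ENNReal.ofReal_le_ofReal (pow_le_pow_left₀ M.coe_nonneg (by linarith) 3))
  have hsubρ : parabolicCylinder ρ z ⊆ parabolicCylinder R z₀ := by
    refine Subset.trans (prod_mono (Ioo_subset_Ioo ?_ le_rfl) (ball_subset_ball hρ.2)) hsub
    nlinarith [hρ.1, hρ.2]
  refine (cknAEss_le_of_weakL3_slices hM1 hum hweak' hρ.1 hsubρ).trans (le_of_eq ?_)
  rw [← ENNReal.ofReal_coe_nnreal]
  push_cast
  rfl

/-- **(2.1) with the mean-free pressure quantity on the left** (as printed, `D₀ = cknDOsc`): under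
the hypotheses of `scaledEnergies_bounded_of_weakL3_slices`,
`A + E + C + D₀ ≤ K'` on `Q(z,r)`, `0 < r ≤ r₀/2` (`D₀ ≤ 4D`, `cknDOsc_le_mul_cknD`; the pressure is
a.e.-strongly measurable on `Q(z₀,R)` as part of `IsSuitableWeakSolutionInBall`).
[cite: Seregin2019, §2 (2.1) (arXiv:1906.06707 p. 5); Seregin2006, Lemma 2.1 (c)] -/
theorem scaledEnergies_bounded_of_weakL3_slices_osc (M E₀ D₀ : ℝ≥0) : ∃ K : ℝ≥0,
    ∀ (z₀ : ℝ × EuclideanSpace ℝ (Fin 3)) (R : ℝ)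
      (u : ℝ → EuclideanSpace ℝ (Fin 3) → EuclideanSpace ℝ (Fin 3))
      (p : ℝ → EuclideanSpace ℝ (Fin 3) → ℝ)
      (G : ℝ → EuclideanSpace ℝ (Fin 3) → EuclideanSpace ℝ (Fin 3) →L[ℝ] EuclideanSpace ℝ (Fin 3)),
      IsSuitableWeakSolutionInBall R z₀ u p →
      HasWeakSpatialGradientOn (parabolicCylinderOpens R z₀) u G →
      (∀ᵐ t ∂(volume.restrict (Ioo (z₀.1 - R ^ 2) z₀.1)),
        AEStronglyMeasurable (u t) (volume.restrict (ball z₀.2 R))) →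
      (∀ t ∈ Ioo (z₀.1 - R ^ 2) z₀.1, ∀ α : ℝ, 0 < α →
        ENNReal.ofReal (α ^ 3) *
            (volume.restrict (ball z₀.2 R)) {x : EuclideanSpace ℝ (Fin 3) | α < ‖u t x‖} ≤
          ENNReal.ofReal ((M : ℝ) ^ 3)) →
      ∀ (z : ℝ × EuclideanSpace ℝ (Fin 3)) (r₀ : ℝ), 0 < r₀ →
        parabolicCylinder r₀ z ⊆ parabolicCylinder R z₀ →
        cknE r₀ z G ≤ E₀ → cknD r₀ z p ≤ D₀ →
        ∀ r ∈ Ioc (0 : ℝ) (r₀ / 2),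
          cknAEss r z u + cknE r z G + cknC r z u + cknDOsc r z p ≤ K := by
  obtain ⟨K, hK⟩ := scaledEnergies_bounded_of_weakL3_slices M E₀ D₀
  refine ⟨4 * K, fun z₀ R u p G hsol hG hum hweak z r₀ hr₀ hsub hE hD r hr => ?_⟩
  have hsum := hK z₀ R u p G hsol hG hum hweak z r₀ hr₀ hsub hE hD r hr
  -- the pressure is a.e.-strongly measurable on the small cylinder
  have hsubr : parabolicCylinder r z ⊆ parabolicCylinder R z₀ := by
    refine Subset.trans (prod_mono (Ioo_subset_Ioo ?_ le_rfl) (ball_subset_ball (by linarith [hr.2])))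
      hsub
    nlinarith [hr.1, hr.2]
  have hp : AEStronglyMeasurable (uncurry p) (volume.restrict (parabolicCylinder r z)) :=
    hsol.2.2.2.aestronglyMeasurable.mono_set hsubr
  have hosc := cknDOsc_le_mul_cknD hr.1 z hp
  have h4 : ∀ x : ℝ≥0∞, x ≤ 4 * x := fun x => by
    calc x = 1 * x := (one_mul x).symm
      _ ≤ 4 * x := by gcongr; norm_num
  calc cknAEss r z u + cknE r z G + cknC r z u + cknDOsc r z p
      ≤ 4 * cknAEss r z u + 4 * cknE r z G + 4 * cknC r z u + 4 * cknD r z p :=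
        add_le_add (add_le_add (add_le_add (h4 _) (h4 _)) (h4 _)) hosc
    _ = 4 * (cknAEss r z u + cknE r z G + cknC r z u + cknD r z p) := by ring
    _ ≤ 4 * (K : ℝ≥0∞) := by gcongr
    _ = ((4 * K : ℝ≥0) : ℝ≥0∞) := by push_cast; rfl

end Literature.Analysis.FluidPDE

end
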